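import Summits.HodgeConjecture.HodgeConjecture.Theorems.F0D6CmCurveBodyA   -- ★ p850704 twin (LAST part; earlier parts ride the import) of tree `Lines/D6CmCurveBodyA.lean` 428393244cbb29c7 (namespaces KEPT ⇒ every served FQN unchanged)
import HarnessLib
import HarnessLib.Audit.LibrarySuggestionsDenyListCruxes

/-! # D6CmCurveBodyA — NEXT EDITION = SHIM (rung-0 re-home; LEAD «M-72» (4) ∕ «M-92» (c): the D-chain twins ride the «D-CHAIN SWEEP (K4-input)», table `F0/P6/L7/LA7-plan/g5/DCHAIN-SWEEP.v1.4` row 1; dealer «L7» LA7-plan (g5) «=» 2026-09-02T10:56:31Z; hand A-p14 (g39), HOME-only cand — NOTHING is written before the LEAD's K4 word)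

The declarations of the tree edition (sha16 428393244cbb29c7, 1447 l., code-`sorry`-free; 42 public declarations in namespaces `Literature.NumberTheory.Automorphic.Liu2021`, `Summit.HodgeConjecture.CorCM.Lines.A3Liu418`, `Summit.HodgeConjecture.CorCM.Lines.A3Liu418.D6Glue`) now live,
byte for byte and under the SAME namespaces, in the ★ twin chain `Theorems.F0D6CmCurveBodyAGlue` (p850460) → `Theorems.F0D6CmCurveBodyAShapes` (p850591) → `Theorems.F0D6CmCurveBodyAJunction` (p850621) → `Theorems.F0D6CmCurveBodyASockets` (p850658) → `Theorems.F0D6CmCurveBodyA` (p850704) (filed by A-p14 (g39); each part imports the previous).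
This module keeps its name so that its tree importers (`D6CmCurveBody.lean`) and by-name readers resolve unchanged through the import above;
it declares nothing.
CUT in the ★ twin under the gate's dedup rules (NOT served by this shim; tree readers outside this module: see the sweep table): `Summit.HodgeConjecture.CorCM.Lines.A3Liu418.D6Glue.finite_setOf_natCast_mem_asIdeal`, `Summit.HodgeConjecture.CorCM.Lines.A3Liu418.complexConj_mul_complexConj`, `Literature.NumberTheory.Automorphic.Liu2021.complexConj_mul_complexConj'`, `Summit.HodgeConjecture.CorCM.Lines.A3Liu418.complexConj_mul_complexConj_GS`.
ORDER NOTE: the sweep writes ALL chain shims in ONE request (NO-CROSS-IMPORT: no environment may hold a `Lines/` ORIGINAL of this chain together with its ★ twin); an importer smoke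
that reads «import … failed, environment already contains …» before the sweep is that order note, not a defect.  Edition history stays in the line card and in git; future
changes are ★-side proposals on the `Theorems/` files.  HC_CM is proved only modulo the 7 printed citations (2 remaining named inputs: hLiu418 = stmt-HodgeConjecture-24832, h413 = stmt-HodgeConjecture-24833) until rung 0 closes; count-neutral (0 `sorry`, 0 socket). -/
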